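import Summits.QuantumFields.YangMills.Theorems.BalabanUVNodesN15PerCubeGreenMinimizerGradientClose
import Summits.QuantumFields.YangMills.Theorems.BalabanUVNodesN15PerCubeGreenSopInverseCloseRaw
import Summits.QuantumFields.YangMills.Theorems.BalabanUVNodesN15BlockRowsMatrixWeighted
import Summits.QuantumFields.YangMills.Theorems.BalabanUVNodesN15CovariantLandauLetterRows
import HarnessLib

/-!
# N15 = NE2, road (c) — PROGRAMME (PC), (PC-D) «the per-cube LANDAU LETTER», IV: THE RAW LANDAU LETTER — the closeness row of
# `D_U(I − R(U))D*_U − ∂(I − R(𝟙))∂ᵀ` on the coloured fine 1-forms for a field (3.35)-small in the trivial gauge near ∕ in the class far, weight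
# `(Σ(r_V) + e^{−δd_Z(z)} + e^{−δd_Z(z′)})·B·e^{−δ|z−z′|}`, assembled from the `E`-rows (n15-c∕307), the coarse inverse difference (n15-c∕308), the flat coarse
# inverse row (n15-c∕222b) and the displayed row of `S(U)⁻¹`, through g23's transpose factorisation (n15-c∕212) and the weighted `A·C·Bᵀ` device (n15-c∕306)
# (dag-n15-c g29, n15-c∕310)

Cell `pub-ymgap`, seat `pub-ymgap-dag-n15-c` (generation g29; R134 (a), s1; HUMAN RULING D-0062).  `bears_on: R4∕N15 · K3⁸ SpineGivenEndpointR13SepCoPHV (stmt-QuantumFields-27366)`;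
filed `--kind proof --supports stmt-QuantumFields-27366 --as helper` — COUNT-NEUTRAL.  One public theorem + three private real-arithmetic lemmas, 0 `sorry`, 0 `def`.  Imports BY NAME
n15-c∕307 `hasMaj_cE_sub_of_reg335` (rows of `E(U)`, `E(𝟙)`, `E(U) − E(𝟙)`), n15-c∕308 `hasMaj_cSop_inv_sub_of_reg335` (`S(U)⁻¹ − S(𝟙)⁻¹`), n15-c∕222b `flatSopRow_ct_uniform` (`S(𝟙)⁻¹`),
n15-c∕212 `landauCov_sub_factorised` (`D(I−R)Dᵀ(U) − D(I−R)Dᵀ(𝟙) = (E−E₁)S⁻¹Eᵀ + E₁(S⁻¹−S₁⁻¹)Eᵀ + E₁S₁⁻¹(E−E₁)ᵀ`), n15-c∕306 `hasMaj_mul_mul_transpose_expW`, n15-c∕297 `hasMaj_comp_nfW`,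
n15-c∕214 `card_fibre_blkV` ∕ `card_fibre_blkC`, lit `hasMaj_id_ofBlocks`.  Nothing in the tree is modified.

WHY ((PC-D), HOME `PCD-DESIGN-g28.md`).  This is the per-cube Landau letter of the vector knit: the difference of the covariant Landau term at the cube's gauged field and at the
trivial field is SMALL near the cube (letters `r_V`, `σ(r_V)`, `(L^m)⁻¹`) and decays away from it, the far cubes (where the field is only in Bałaban's class) entering through the
weights `e^{−δd_Z}` at EITHER end — the consumer cuts both ends to the cube.  No adjoint entry of (3.42) is used: the transposed factors pair with whole fine blocks (n15-c∕213∕306), the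
cardinal `(d+1)(L^k)^{d+1}|ι|` of a bond block cancelling the two scales `(L^k)^{−(d+1)}` of `Q′ᵀ` against the scale `(L^k)^{d+1}` of the coarse inverse.

WHAT.  ★★★ `hasMaj_landauCov_sub_of_reg335`: for `(d, L, a₀, ι)` and row letters `B_I ≥ 0`, `δ_I > 0` there are `δ, w₀, R₀, B` such that under n15-c∕307's hypotheses (`Far`, `Z`,
Lipschitz minorant `d_Z ≥ 0`, `U` (3.35)-small in the trivial gauge on the TWO-collar boxes `c(2L^m+2,k)+[0,6L^m+5)^{d+1}` of the cubes not `Far`, in the class on those of the far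
cubes, letters `r_V`, `Σ ≤ R₀`) and the displayed row `mulVecLin S(U)⁻¹ ≤ B_I(L^k)^{d+1}e^{−δ_I|y−y′|}`:
`mulVecLin (landauCov (cvT e U) a_K) − mulVecLin (landauCov 𝟙 a_K) ≤ B·(Σ(r_V) + e^{−δd_Z(z)} + e^{−δd_Z(z′)})·e^{−δ|z−z′|_T}` on the coloured bond carrier,
`Σ(r_V) = r_V(1+|J⊕J|) + a_K|ι|(|ι|σ²+2σ) + σ + (L^m)⁻¹`.  The one-collar data n15-c∕308 wants are restricted from the two-collar data (`reg335Cube_anti`, `mem_cubeBlocks_of_mem_inner`).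

HONEST FRAMING ∕ LIMITS.  MODEL carriers (the cover of n15-c∕260 on the doubled unit torus); composition of LANDED theorems over displayed rows; [B9] (3.49) p.399, Thm 3.4 p.400,
(3.25)–(3.26) pp.394–395, (3.34)–(3.35) p.396, (3.95)–(3.96) p.411 and [B6] (2.52)–(2.56) cited for SHAPES ∕ MECHANISM, NOT the printed statements.  NE2⁺ NOT PRINTED, NOT proved; N15 of
record untouched (DISCHARGED AS CONSUMED, p687738); K3⁸ OPEN; counts of record UNMOVED; one finite 𝕋⁴ at fixed ε per index — NOT infinite volume, NOT OS on ℝ⁴, NOT a mass gap, NOT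
Clay.  Restate-immune (no Theses import).
-/

noncomputable section

open scoped BigOperators Matrix Matrix.Norms.L2Operator

namespace Summit.QuantumFields.YangMills.BalabanUVNodes.N15.Gluing

open Real
open Literature.MathematicalPhysics.QuantumFieldTheory.Balaban1983to89
open Literature.MathematicalPhysics.QuantumFieldTheory.Balaban1983to89.B5Prop11Plancherel (Tor fine unitVec)
open Literature.MathematicalPhysics.QuantumFieldTheory.Balaban1983to89.B11SectG (BlockNorm HasMaj RowSum)
open Literature.MathematicalPhysics.QuantumFieldTheory.Balaban1983to89.B6RandomWalk (Triangle254)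
open Literature.MathematicalPhysics.QuantumFieldTheory.Balaban1983to89.B6UnitTorusCarrier (unitTorusGeo triangle254_unitTorusGeo rowSum_unitTorusGeo unitTorusGeo_dist_nonneg unitTorusGeo_dist_self unitTorusGeo_dist_symm)
open Literature.MathematicalPhysics.QuantumFieldTheory.Balaban1983to89.B9Eq335RegularityClasses (Reg335Cube)
open Literature.MathematicalPhysics.QuantumFieldTheory.Balaban1983to89.B9Eq3117Current (gaugeTr)
open Literature.MathematicalPhysics.QuantumFieldTheory.Balaban1983to89.B9Eq39Adjoint (covD fluct)
open Literature.MathematicalPhysics.QuantumFieldTheory.Balaban1983to89.B9Eq3130MatrixLetters (hasMaj_id_ofBlocks)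
open Literature.MathematicalPhysics.QuantumFieldTheory.Balaban1983to89.T4EtaRateCoeffDefect (fibre)
open Summit.QuantumFields.YangMills.BalabanUVNodes.N15.CovLandau (cSop cE landauCov landauCov_sub_factorised flatSopRow_ct_uniform isUnit_cSop mulVecLin_sub' card_fibre_blkV card_fibre_blkC)
open Summit.QuantumFields.YangMills.BalabanUVNodes.N15.BlockRows (hasMaj_mul_mul_transpose_expW)
open Summit.QuantumFields.YangMills.BalabanUVNodes.N15.BackgroundModel (kappa_ofBlocks)
open Literature.MathematicalPhysics.QuantumFieldTheory.King1986 (aK aK_pos aK_le aK_ge)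
open Literature.MathematicalPhysics.QuantumFieldTheory.King1986.Torus (blockOf)
open Literature.Barriers.QuantumFields (traceForm)
open Summit.QuantumFields.YangMills.BalabanUVNodes.N15.MatrixSpecies (basisConst liftBlk)
open Summit.QuantumFields.YangMills.BalabanUVNodes.N15.TwoGrid (cubeBlocks)

variable {d : ℕ}

section Arith

/-- bookkeeping: `(S + e₁)·v·K·E₁ ≤ (S + e₀)·(K′E₀)` for `v = 1`, `K = K′ ≥ 0`, `e₁ ≤ e₀`, `E₁ ≤ E₀`, everything non-negative. [folklore] -/
private theorem wb_left {S e₁ e₀ v K K' E₁ E₀ : ℝ} (hS : 0 ≤ S) (he₁ : 0 ≤ e₁) (he : e₁ ≤ e₀) (hv : v = 1) (hK : K = K') (hK' : 0 ≤ K') (hE₁ : 0 ≤ E₁) (hE : E₁ ≤ E₀) :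
    (S + e₁) * v * K * E₁ ≤ (S + e₀) * (K' * E₀) := by
  rw [hv, mul_one, hK]
  have h0 : 0 ≤ S + e₀ := by linarith
  calc (S + e₁) * K' * E₁ ≤ (S + e₀) * K' * E₁ := mul_le_mul_of_nonneg_right (mul_le_mul_of_nonneg_right (by linarith) hK') hE₁
    _ ≤ (S + e₀) * K' * E₀ := mul_le_mul_of_nonneg_left hE (mul_nonneg h0 hK')
    _ = (S + e₀) * (K' * E₀) := by ring

/-- bookkeeping: `v·(S + e₁)·K·E₁ ≤ (S + e₀)·(K′E₀)` (the weight on the right factor). [folklore] -/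
private theorem wb_right {S e₁ e₀ v K K' E₁ E₀ : ℝ} (hS : 0 ≤ S) (he₁ : 0 ≤ e₁) (he : e₁ ≤ e₀) (hv : v = 1) (hK : K = K') (hK' : 0 ≤ K') (hE₁ : 0 ≤ E₁) (hE : E₁ ≤ E₀) :
    v * (S + e₁) * K * E₁ ≤ (S + e₀) * (K' * E₀) := by
  rw [hv, one_mul, hK]
  have h0 : 0 ≤ S + e₀ := by linarith
  calc (S + e₁) * K' * E₁ ≤ (S + e₀) * K' * E₁ := mul_le_mul_of_nonneg_right (mul_le_mul_of_nonneg_right (by linarith) hK') hE₁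
    _ ≤ (S + e₀) * K' * E₀ := mul_le_mul_of_nonneg_left hE (mul_nonneg h0 hK')
    _ = (S + e₀) * (K' * E₀) := by ring

/-- bookkeeping: the three words under one weight `(S + a + b)`. [folklore] -/
private theorem sum3_le {S a b K₁ K₂ K₃ E : ℝ} (hS : 0 ≤ S) (ha : 0 ≤ a) (hb : 0 ≤ b) (h1 : 0 ≤ K₁) (h2 : 0 ≤ K₂) (h3 : 0 ≤ K₃) (hE : 0 ≤ E) :
    (S + a) * (K₁ * E) + (S + a) * (K₂ * E) + (S + b) * (K₃ * E) ≤ (K₁ + K₂ + K₃ + 1) * (S + a + b) * E := by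
  have hT : 0 ≤ S + a + b := by linarith
  have e1 : (S + a) * (K₁ * E) ≤ (S + a + b) * (K₁ * E) := mul_le_mul_of_nonneg_right (by linarith) (mul_nonneg h1 hE)
  have e2 : (S + a) * (K₂ * E) ≤ (S + a + b) * (K₂ * E) := mul_le_mul_of_nonneg_right (by linarith) (mul_nonneg h2 hE)
  have e3 : (S + b) * (K₃ * E) ≤ (S + a + b) * (K₃ * E) := mul_le_mul_of_nonneg_right (by linarith) (mul_nonneg h3 hE)
  have e4 : 0 ≤ (S + a + b) * E := mul_nonneg hT hE
  nlinarith [e1, e2, e3, e4]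

end Arith

section Letter

variable {L : ℕ} [NeZero L]

set_option maxHeartbeats 800000 in
/-- ★★★ **THE RAW PER-CUBE LANDAU LETTER.**  n15-c∕307's hypotheses (`Far`, `Z`, Lipschitz minorant `d_Z ≥ 0`, `U` (3.35)-small in the trivial gauge on the two-collar boxes of the cubes
not `Far`, in Bałaban's class on those of the far cubes, letters `r_V`, `Σ ≤ R₀`) and the DISPLAYED row `mulVecLin S(U)⁻¹ ≤ B_I(L^k)^{d+1}e^{−δ_I|y−y′|}` ⟹ on the coloured bond carrier
`mulVecLin (D_U(I − R(U))D*_U) − mulVecLin (∂(I − R(𝟙))∂ᵀ) ≤ B·(r_V(1+|J⊕J|) + R_N + σ + (L^m)⁻¹ + e^{−δd_Z(z)} + e^{−δd_Z(z′)})·e^{−δ|z−z′|_T}`, `B` depending on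
`(d, L, a₀, |ι|, B_I, δ_I)` only — the three words of n15-c∕212's factorisation, each through n15-c∕306.  MODEL carriers; the SHAPE of [B9] (3.49) ∕ Thm 3.4.
[cite: Balaban1985BackgroundPropagators, (3.49) p.399, Thm 3.4 p.400, (3.25)–(3.26) pp.394–395, (3.34)–(3.35) p.396, (3.95)–(3.96) p.411 (shape ∕ mechanism); Balaban1984PropagatorsII, (2.52)–(2.56) pp.232–233, Lemma 2.1 (2.61) p.234] -/
theorem hasMaj_landauCov_sub_of_reg335 (hL : Odd L ∧ 1 < L) (hL7 : 7 ≤ L) {a₀ : ℝ} (ha₀ : 0 < a₀) (ι : Type) [Fintype ι] [DecidableEq ι] {BI δI : ℝ} (hBI : 0 ≤ BI) (hδI : 0 < δI) :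
    ∃ δ w₀ R₀ B : ℝ, 0 < δ ∧ 0 < R₀ ∧ 0 < B ∧
      ∀ (mv kk : ℕ), 1 ≤ kk → w₀ ≤ ((L ^ mv : ℕ) : ℝ) →
      ∀ {mm : Type} [Fintype mm] [DecidableEq mm] [Nonempty mm] (e : Matrix mm mm ℂ ≃L[ℝ] (ι → ℝ)), (∀ A B : Matrix mm mm ℂ, traceForm A B = e A ⬝ᵥ e B) →
      ∀ (Far : (Fin (d + 1) → ZMod (2 * L)) → Prop) [DecidablePred Far] (Z : Set (Tor (cvM d L mv kk hL))) (dZ : Tor (cvM d L mv kk hL) → ℝ),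
        (∀ y z, z ∈ Z → dZ y ≤ (unitTorusGeo L kk (cvM d L mv kk hL)).dist y z) → (∀ y, 0 ≤ dZ y) → (∀ y z, dZ y ≤ (unitTorusGeo L kk (cvM d L mv kk hL)).dist y z + dZ z) →
        (∀ k, Far k → cvSk d L mv kk hL k ⊆ Z) →
      ∀ (U : Fin (d + 1) → ScX d L mv kk hL → (Matrix mm mm ℂ)ˣ), (∀ μ x, (U μ x : Matrix mm mm ℂ) ∈ Matrix.unitaryGroup mm ℂ) →
      ∀ (ξ C : ℝ), 0 < ξ → 0 < C →
        (∀ k, Far k → Reg335Cube (scShift d L mv kk hL) U ((((L ^ kk : ℕ) : ℝ))⁻¹) {x : ScX d L mv kk hL | blockOf (L ^ kk) (cvM d L mv kk hL) x ∈ cubeBlocks (cvM d L mv kk hL) (coverCorner (cvM d L mv kk hL) (L ^ mv) L (2 * L ^ mv + 2) k) (6 * L ^ mv + 5)} ξ C) →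
        (∀ k, ¬Far k → ∃ A : Fin (d + 1) → ScX d L mv kk hL → Matrix mm mm ℂ, (∀ μ, ∀ z ∈ {x : ScX d L mv kk hL | blockOf (L ^ kk) (cvM d L mv kk hL) x ∈ cubeBlocks (cvM d L mv kk hL) (coverCorner (cvM d L mv kk hL) (L ^ mv) L (2 * L ^ mv + 2) k) (6 * L ^ mv + 5)}, gaugeTr (scShift d L mv kk hL) (fun _ => (1 : (Matrix mm mm ℂ)ˣ)) U μ z = fluct ((((L ^ kk : ℕ) : ℝ))⁻¹) A μ z) ∧
          (∀ μ, ∀ z ∈ {x : ScX d L mv kk hL | blockOf (L ^ kk) (cvM d L mv kk hL) x ∈ cubeBlocks (cvM d L mv kk hL) (coverCorner (cvM d L mv kk hL) (L ^ mv) L (2 * L ^ mv + 2) k) (6 * L ^ mv + 5)}, ‖A μ z‖ < C * ξ⁻¹) ∧ (∀ μ ν, ∀ z ∈ {x : ScX d L mv kk hL | blockOf (L ^ kk) (cvM d L mv kk hL) x ∈ cubeBlocks (cvM d L mv kk hL) (coverCorner (cvM d L mv kk hL) (L ^ mv) L (2 * L ^ mv + 2) k) (6 * L ^ mv + 5)},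 ‖((↑((((L ^ kk : ℕ) : ℝ))⁻¹) : ℂ)⁻¹) • covD (scShift d L mv kk hL) (fun _ _ => (1 : (Matrix mm mm ℂ)ˣ)) μ (A ν) z‖ < C * (ξ ^ 2)⁻¹)) →
      ∀ (rV : ℝ), 0 ≤ rV →
        Fintype.card ι * (@basisConst ι _ (Matrix mm mm ℂ) Matrix.frobeniusNormedAddCommGroup Matrix.frobeniusNormedSpace e * (2 * Real.sqrt (Fintype.card mm)) * (Real.sqrt (Fintype.card mm) * ((C / ξ) * Real.exp (((((L ^ kk : ℕ) : ℝ))⁻¹) * (C / ξ))))) ≤ rV →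
        Fintype.card ι * (Fintype.card (Fin (d + 1)) * (Fintype.card ι * (@basisConst ι _ (Matrix mm mm ℂ) Matrix.frobeniusNormedAddCommGroup Matrix.frobeniusNormedSpace e * (2 * Real.sqrt (Fintype.card mm)) * (Real.sqrt (Fintype.card mm) * ((C / ξ) * Real.exp (((((L ^ kk : ℕ) : ℝ))⁻¹) * (C / ξ))))) ^ 2 + @basisConst ι _ (Matrix mm mm ℂ) Matrix.frobeniusNormedAddCommGroup Matrix.frobeniusNormedSpace e * (2 * Real.sqrt (Fintype.card mm)) * (Real.sqrt (Fintype.card mm) * ((C / ξ ^ 2) * Real.exp (((((L ^ kk : ℕ) : ℝ))⁻¹) * (C / ξ)))))) ≤ rV →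
        rV * (1 + Fintype.card (Fin (d + 1) ⊕ Fin (d + 1))) + a₀ * (Fintype.card ι * (Fintype.card ι * ((1 + rV * ((((L ^ kk : ℕ) : ℝ))⁻¹)) ^ ((d + 1) * L ^ kk) - 1) ^ 2 + 2 * ((1 + rV * ((((L ^ kk : ℕ) : ℝ))⁻¹)) ^ ((d + 1) * L ^ kk) - 1))) ≤ R₀ →
        HasMaj (BlockNorm.ofBlocks (unitTorusGeo L kk (cvM d L mv kk hL)) (liftBlk (fun y : Tor (cvM d L mv kk hL) => y) ι)) (BlockNorm.ofBlocks (unitTorusGeo L kk (cvM d L mv kk hL)) (liftBlk (fun y : Tor (cvM d L mv kk hL) => y) ι)) (Matrix.mulVecLin (cSop (cvM d L mv kk hL) (L ^ kk) (cvT e (fun μ x => (U μ x : Matrix mm mm ℂ))) (aK a₀ (L : ℝ) kk * (((L ^ kk : ℕ) : ℝ)) ^ (d + 1)))⁻¹) (fun y y' => BI * (((L ^ kk : ℕ) : ℝ)) ^ (d + 1) * Real.exp (-(δI * (unitTorusGeo L kk (cvM d L mv kk hL)).dist y y'))) →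
        HasMaj (BlockNorm.ofBlocks (unitTorusGeo L kk (cvM d L mv kk hL)) (liftBlk (fun b : ScX d L mv kk hL × Fin (d + 1) => blockOf (L ^ kk) (cvM d L mv kk hL) b.1) ι)) (BlockNorm.ofBlocks (unitTorusGeo L kk (cvM d L mv kk hL)) (liftBlk (fun b : ScX d L mv kk hL × Fin (d + 1) => blockOf (L ^ kk) (cvM d L mv kk hL) b.1) ι))
          (Matrix.mulVecLin (landauCov (cvM d L mv kk hL) (L ^ kk) (cvT e (fun μ x => (U μ x : Matrix mm mm ℂ))) (aK a₀ (L : ℝ) kk * (((L ^ kk : ℕ) : ℝ)) ^ (d + 1))) - Matrix.mulVecLin (landauCov (cvM d L mv kk hL) (L ^ kk) (fun (_ : Fin (d + 1)) (_ : ScX d L mv kk hL) => (1 : Matrix ι ι ℝ)) (aK a₀ (L : ℝ) kk * (((L ^ kk : ℕ) : ℝ)) ^ (d + 1))))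
          (fun z z' => B * (rV * (1 + Fintype.card (Fin (d + 1) ⊕ Fin (d + 1))) + aK a₀ (L : ℝ) kk * (Fintype.card ι * (Fintype.card ι * ((1 + rV * ((((L ^ kk : ℕ) : ℝ))⁻¹)) ^ ((d + 1) * L ^ kk) - 1) ^ 2 + 2 * ((1 + rV * ((((L ^ kk : ℕ) : ℝ))⁻¹)) ^ ((d + 1) * L ^ kk) - 1))) + ((1 + rV * ((((L ^ kk : ℕ) : ℝ))⁻¹)) ^ ((d + 1) * L ^ kk) - 1) + (((L ^ mv : ℕ) : ℝ))⁻¹ + Real.exp (-(δ * dZ z)) + Real.exp (-(δ * dZ z'))) * Real.exp (-(δ * (unitTorusGeo L kk (cvM d L mv kk hL)).dist z z'))) := by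
  classical
  have hL1r : (1 : ℝ) < (L : ℝ) := by exact_mod_cast hL.2
  have haKlo : ∀ K : ℕ, 1 ≤ K → a₀ / 2 ≤ aK a₀ (L : ℝ) K := fun K hK => by
    have h1 := aK_ge ha₀ hL1r hK (a := a₀)
    have hL2 : (2 : ℝ) ≤ (L : ℝ) := by exact_mod_cast (show 2 ≤ L by omega)
    have hL4 : (4 : ℝ) ≤ (L : ℝ) ^ 2 := by nlinarith
    have hinv : ((L : ℝ) ^ 2)⁻¹ ≤ 1 / 4 := by rw [one_div]; exact inv_anti₀ (by norm_num) hL4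
    have h2 := mul_le_mul_of_nonneg_left hinv ha₀.le
    nlinarith
  obtain ⟨δ₇, w₇, R₇, B₇, hδ₇, hR₇, hB₇, H₇⟩ := hasMaj_cE_sub_of_reg335 (d := d) hL hL7 ha₀ ι
  obtain ⟨δ₈, w₈, R₈, B₈, hδ₈, hR₈, hB₈, H₈⟩ := hasMaj_cSop_inv_sub_of_reg335 (d := d) hL hL7 ha₀ ι hBI hδI
  obtain ⟨CS, δS, hCS, hδS, HS⟩ := flatSopRow_ct_uniform (d := d) L (a₁ := a₀ / 2) (a₂ := a₀) (by positivity) (by linarith)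
  -- rates: common decay `δ₀`, final rate ∕ weight rate ∕ row-sum margin `m = δ₀∕4`
  set δ₀ : ℝ := min (min δ₇ δ₈) (min δS δI) with hδ₀def
  have hδ₀ : 0 < δ₀ := lt_min (lt_min hδ₇ hδ₈) (lt_min hδS hδI)
  have hδ₀₇ : δ₀ ≤ δ₇ := (min_le_left _ _).trans (min_le_left _ _)
  have hδ₀₈ : δ₀ ≤ δ₈ := (min_le_left _ _).trans (min_le_right _ _)
  have hδ₀S : δ₀ ≤ δS := (min_le_right _ _).trans (min_le_left _ _)
  have hδ₀I : δ₀ ≤ δI := (min_le_right _ _).trans (min_le_right _ _)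
  set m : ℝ := δ₀ / 4 with hmdef
  have hm : 0 < m := by positivity
  set cr : ℝ := B4Sect5Proof.latticeConst (d + 1) m with hcrdef
  have hcr0 : 0 ≤ cr := B4Sect5Proof.latticeConst_nonneg (d + 1) hm.le
  have hK1c0 : 0 ≤ (((d + 1 : ℕ) : ℝ) * ((Fintype.card ι : ℝ) * (Fintype.card ι : ℝ) * (Fintype.card ι : ℝ)) * (B₇ * B₇) * BI * (cr * cr)) := by positivity
  have hK2c0 : 0 ≤ (((d + 1 : ℕ) : ℝ) * ((Fintype.card ι : ℝ) * (Fintype.card ι : ℝ) * (Fintype.card ι : ℝ)) * (B₇ * B₇) * B₈ * (cr * cr * cr)) := by positivity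
  have hK3c0 : 0 ≤ (((d + 1 : ℕ) : ℝ) * ((Fintype.card ι : ℝ) * (Fintype.card ι : ℝ) * (Fintype.card ι : ℝ)) * (B₇ * B₇) * CS * (cr * cr)) := by positivity
  refine ⟨m, max w₇ w₈, min R₇ R₈, ((((d + 1 : ℕ) : ℝ) * ((Fintype.card ι : ℝ) * (Fintype.card ι : ℝ) * (Fintype.card ι : ℝ)) * (B₇ * B₇) * BI * (cr * cr)) + (((d + 1 : ℕ) : ℝ) * ((Fintype.card ι : ℝ) * (Fintype.card ι : ℝ) * (Fintype.card ι : ℝ)) * (B₇ * B₇) * B₈ * (cr * cr * cr)) + (((d + 1 : ℕ) : ℝ) * ((Fintype.card ι : ℝ) * (Fintype.card ι : ℝ) * (Fintype.card ι : ℝ)) * (B₇ * B₇) * CS * (cr * cr)) + 1), hm, lt_min hR₇ hR₈, by positivity, fun mv kk hk hw₀ => ?_⟩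
  intro mm _ _ _ e he Far _ Z dZ hdZ hdZ0 hdZl hZ U hU ξ C hξ hC hfar hnear rV hrV hrA hrC hRle hSi
  have hw₇ : w₇ ≤ ((L ^ mv : ℕ) : ℝ) := (le_max_left _ _).trans hw₀
  have hw₈ : w₈ ≤ ((L ^ mv : ℕ) : ℝ) := (le_max_right _ _).trans hw₀
  have hd : ∀ a b : Tor (cvM d L mv kk hL), 0 ≤ (unitTorusGeo L kk (cvM d L mv kk hL)).dist a b := unitTorusGeo_dist_nonneg L kk _
  have hsymm : ∀ a b : Tor (cvM d L mv kk hL), (unitTorusGeo L kk (cvM d L mv kk hL)).dist a b = (unitTorusGeo L kk (cvM d L mv kk hL)).dist b a := unitTorusGeo_dist_symm L kk _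
  have hdself : ∀ y : Tor (cvM d L mv kk hL), (unitTorusGeo L kk (cvM d L mv kk hL)).dist y y = 0 := unitTorusGeo_dist_self L kk _
  have htri : Triangle254 (unitTorusGeo L kk (cvM d L mv kk hL)) := triangle254_unitTorusGeo L kk _
  have hrow : RowSum (unitTorusGeo L kk (cvM d L mv kk hL)) m cr := by rw [hcrdef]; exact rowSum_unitTorusGeo L kk _ hm
  have hnpos : (0 : ℝ) < (((L ^ kk : ℕ) : ℝ)) ^ (d + 1) := by positivity
  have hnn : ((((L ^ kk : ℕ) : ℝ)) ^ (d + 1))⁻¹ * (((L ^ kk : ℕ) : ℝ)) ^ (d + 1) = 1 := inv_mul_cancel₀ hnpos.ne'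
  have hκ : (BlockNorm.ofBlocks (unitTorusGeo L kk (cvM d L mv kk hL)) (liftBlk (fun y : Tor (cvM d L mv kk hL) => y) ι)).κ = 1 := kappa_ofBlocks _
  have hκ0 : (0 : ℝ) ≤ (BlockNorm.ofBlocks (unitTorusGeo L kk (cvM d L mv kk hL)) (liftBlk (fun y : Tor (cvM d L mv kk hL) => y) ι)).κ := by rw [hκ]; exact zero_le_one
  have hrate : ∀ ⦃c ρ ρ' : ℝ⦄, 0 ≤ c → ρ' ≤ ρ → ∀ y y' : Tor (cvM d L mv kk hL), c * Real.exp (-(ρ * (unitTorusGeo L kk (cvM d L mv kk hL)).dist y y')) ≤ c * Real.exp (-(ρ' * (unitTorusGeo L kk (cvM d L mv kk hL)).dist y y')) :=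
    fun c ρ ρ' hc hρ y y' => mul_le_mul_of_nonneg_left (Real.exp_le_exp.mpr (by nlinarith only [hd y y', hρ])) hc
  have hexp : ∀ ⦃ρ ρ' : ℝ⦄, ρ' ≤ ρ → ∀ y y' : Tor (cvM d L mv kk hL), Real.exp (-(ρ * (unitTorusGeo L kk (cvM d L mv kk hL)).dist y y')) ≤ Real.exp (-(ρ' * (unitTorusGeo L kk (cvM d L mv kk hL)).dist y y')) :=
    fun ρ ρ' hρ y y' => Real.exp_le_exp.mpr (by nlinarith only [hd y y', hρ])
  have hexpZ : ∀ ⦃ρ ρ' : ℝ⦄, ρ' ≤ ρ → ∀ y : Tor (cvM d L mv kk hL), Real.exp (-(ρ * dZ y)) ≤ Real.exp (-(ρ' * dZ y)) :=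
    fun ρ ρ' hρ y => Real.exp_le_exp.mpr (by nlinarith only [hdZ0 y, hρ])
  have hSIG0 : 0 ≤ ((1 + rV * ((((L ^ kk : ℕ) : ℝ))⁻¹)) ^ ((d + 1) * L ^ kk) - 1) := by
    have := one_le_pow₀ (M₀ := ℝ) (a := 1 + rV * ((((L ^ kk : ℕ) : ℝ))⁻¹)) (le_add_of_nonneg_right (by positivity)) (n := (d + 1) * L ^ kk); linarith only [this]
  have hSum0 : 0 ≤ rV * (1 + Fintype.card (Fin (d + 1) ⊕ Fin (d + 1))) + aK a₀ (L : ℝ) kk * (Fintype.card ι * (Fintype.card ι * ((1 + rV * ((((L ^ kk : ℕ) : ℝ))⁻¹)) ^ ((d + 1) * L ^ kk) - 1) ^ 2 + 2 * ((1 + rV * ((((L ^ kk : ℕ) : ℝ))⁻¹)) ^ ((d + 1) * L ^ kk) - 1))) + ((1 + rV * ((((L ^ kk : ℕ) : ℝ))⁻¹)) ^ ((d + 1) * L ^ kk) - 1) + (((L ^ mv : ℕ) : ℝ))⁻¹ := by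
    have haK := aK_pos ha₀ hL1r hk
    exact add_nonneg (add_nonneg (add_nonneg (mul_nonneg hrV (by positivity)) (mul_nonneg haK.le (mul_nonneg (Nat.cast_nonneg _) (add_nonneg (by positivity) (mul_nonneg zero_le_two hSIG0))))) hSIG0) (by positivity)
  -- geometry: the one-collar boxes inside the two-collar boxes
  have hM : ∀ ν, cvM d L mv kk hL ν = 2 * L * L ^ mv := MP_succ_eq L mv kk hL
  have hS5 : 6 * L ^ mv + 5 ≤ 2 * L * L ^ mv := by
    have hw1 : 1 ≤ L ^ mv := Nat.one_le_pow _ _ (by omega)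
    have h7 : 7 * L ^ mv ≤ L * L ^ mv := Nat.mul_le_mul_right _ hL7
    have e2 : 2 * L * L ^ mv = 2 * (L * L ^ mv) := by ring
    rw [e2]; omega
  have hsub : ∀ (k : Fin (d + 1) → ZMod (2 * L)) (x : ScX d L mv kk hL), blockOf (L ^ kk) (cvM d L mv kk hL) x ∈ cubeBlocks (cvM d L mv kk hL) (coverCorner (cvM d L mv kk hL) (L ^ mv) L (2 * L ^ mv + 1) k) (6 * L ^ mv + 3) →
      blockOf (L ^ kk) (cvM d L mv kk hL) x ∈ cubeBlocks (cvM d L mv kk hL) (coverCorner (cvM d L mv kk hL) (L ^ mv) L (2 * L ^ mv + 2) k) (6 * L ^ mv + 5) :=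
    fun k x hx => mem_cubeBlocks_of_mem_inner (m₀ := 2 * L ^ mv + 2) (S₀ := 6 * L ^ mv + 5) hM (by omega) (by omega) hS5 hx
  have hfar₁ : ∀ k, Far k → Reg335Cube (scShift d L mv kk hL) U ((((L ^ kk : ℕ) : ℝ))⁻¹) {x : ScX d L mv kk hL | blockOf (L ^ kk) (cvM d L mv kk hL) x ∈ cubeBlocks (cvM d L mv kk hL) (coverCorner (cvM d L mv kk hL) (L ^ mv) L (2 * L ^ mv + 1) k) (6 * L ^ mv + 3)} ξ C :=
    fun k hk => reg335Cube_anti (scShift d L mv kk hL) U (fun x hx => hsub k x hx) (hfar k hk)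
  have hnear₁ : ∀ k, ¬Far k → ∃ A : Fin (d + 1) → ScX d L mv kk hL → Matrix mm mm ℂ, (∀ μ, ∀ z ∈ {x : ScX d L mv kk hL | blockOf (L ^ kk) (cvM d L mv kk hL) x ∈ cubeBlocks (cvM d L mv kk hL) (coverCorner (cvM d L mv kk hL) (L ^ mv) L (2 * L ^ mv + 1) k) (6 * L ^ mv + 3)}, gaugeTr (scShift d L mv kk hL) (fun _ => (1 : (Matrix mm mm ℂ)ˣ)) U μ z = fluct ((((L ^ kk : ℕ) : ℝ))⁻¹) A μ z) ∧
      (∀ μ, ∀ z ∈ {x : ScX d L mv kk hL | blockOf (L ^ kk) (cvM d L mv kk hL) x ∈ cubeBlocks (cvM d L mv kk hL) (coverCorner (cvM d L mv kk hL) (L ^ mv) L (2 * L ^ mv + 1) k) (6 * L ^ mv + 3)}, ‖A μ z‖ < C * ξ⁻¹) ∧ (∀ μ ν, ∀ z ∈ {x : ScX d L mv kk hL | blockOf (L ^ kk) (cvM d L mv kk hL) x ∈ cubeBlocks (cvM d L mv kk hL) (coverCorner (cvM d L mv kk hL) (L ^ mv) L (2 * L ^ mv + 1) k) (6 * L ^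 mv + 3)}, ‖((↑((((L ^ kk : ℕ) : ℝ))⁻¹) : ℂ)⁻¹) • covD (scShift d L mv kk hL) (fun _ _ => (1 : (Matrix mm mm ℂ)ˣ)) μ (A ν) z‖ < C * (ξ ^ 2)⁻¹) := by
    intro k hk
    obtain ⟨A, h1, h2, h3⟩ := hnear k hk
    exact ⟨A, fun μ z hz => h1 μ z (hsub k z hz), fun μ z hz => h2 μ z (hsub k z hz), fun μ ν z hz => h3 μ ν z (hsub k z hz)⟩
  -- the rows: `E(U)`, `E(𝟙)`, `E(U) − E(𝟙)` (n15-c∕307); `S(U)⁻¹ − S(𝟙)⁻¹` (n15-c∕308); `S(𝟙)⁻¹` (n15-c∕222b); `S(U)⁻¹` (displayed)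
  obtain ⟨hEV, hE1, hδE⟩ := H₇ mv kk hk hw₇ e he Far Z dZ hdZ hdZ0 hdZl hZ U hU ξ C hξ hC hfar hnear rV hrV hrA hrC (hRle.trans (min_le_left _ _))
  have hδSi := H₈ mv kk hk hw₈ e he Far Z dZ hdZ hdZ0 hdZl hZ U hU ξ C hξ hC hfar₁ hnear₁ rV hrV hrA hrC (hRle.trans (min_le_right _ _)) hSi
  have hblk : ∀ z : Tor (cvM d L mv kk hL), (fibre (liftBlk (fun b : ScX d L mv kk hL × Fin (d + 1) => blockOf (L ^ kk) (cvM d L mv kk hL) b.1) ι) z).card ≤ (d + 1) * (L ^ kk) ^ (d + 1) * Fintype.card ι := fun z => (card_fibre_blkV (cvM d L mv kk hL) (L ^ kk) ι z).le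
  have hblkC : ∀ w : Tor (cvM d L mv kk hL), (fibre (liftBlk (fun y : Tor (cvM d L mv kk hL) => y) ι) w).card ≤ Fintype.card ι := fun w => (card_fibre_blkC (cvM d L mv kk hL) ι w).le
  have hA1 : HasMaj (BlockNorm.ofBlocks (unitTorusGeo L kk (cvM d L mv kk hL)) (liftBlk (fun y : Tor (cvM d L mv kk hL) => y) ι)) (BlockNorm.ofBlocks (unitTorusGeo L kk (cvM d L mv kk hL)) (liftBlk (fun b : ScX d L mv kk hL × Fin (d + 1) => blockOf (L ^ kk) (cvM d L mv kk hL) b.1) ι)) (Matrix.mulVecLin (cE (cvM d L mv kk hL) (L ^ kk) (cvT e (fun μ x => (U μ x : Matrix mm mm ℂ))) (aK a₀ (L : ℝ) kk * (((L ^ kk : ℕ) : ℝ)) ^ (d + 1)) - cE (cvM d L mv kk hL) (L ^ kk) (fun (_ : Fin (d + 1)) (_ : ScX d L mv kk hL) => (1 : Matrix ι ι ℝ)) (aK a₀ (L : ℝ) kk * (((L ^ kk : ℕ) : ℝ)) ^ (d + 1)))) (fun z w => (rV * (1 + Fintype.card (Fin (d + 1) ⊕ Fin (d + 1))) + aK a₀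 (L : ℝ) kk * (Fintype.card ι * (Fintype.card ι * ((1 + rV * ((((L ^ kk : ℕ) : ℝ))⁻¹)) ^ ((d + 1) * L ^ kk) - 1) ^ 2 + 2 * ((1 + rV * ((((L ^ kk : ℕ) : ℝ))⁻¹)) ^ ((d + 1) * L ^ kk) - 1))) + ((1 + rV * ((((L ^ kk : ℕ) : ℝ))⁻¹)) ^ ((d + 1) * L ^ kk) - 1) + (((L ^ mv : ℕ) : ℝ))⁻¹ + Real.exp (-(δ₀ * dZ z))) * (B₇ * ((((L ^ kk : ℕ) : ℝ)) ^ (d + 1))⁻¹ * Real.exp (-(δ₀ * (unitTorusGeo L kk (cvM d L mv kk hL)).dist z w)))) := by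
    rw [mulVecLin_sub']
    refine hδE.mono fun z w => ?_
    have e1 := hexpZ hδ₀₇ z
    have e2 := hexp hδ₀₇ z w
    have hB : (0 : ℝ) ≤ B₇ * ((((L ^ kk : ℕ) : ℝ)) ^ (d + 1))⁻¹ := by positivity
    have h0 : 0 ≤ rV * (1 + Fintype.card (Fin (d + 1) ⊕ Fin (d + 1))) + aK a₀ (L : ℝ) kk * (Fintype.card ι * (Fintype.card ι * ((1 + rV * ((((L ^ kk : ℕ) : ℝ))⁻¹)) ^ ((d + 1) * L ^ kk) - 1) ^ 2 + 2 * ((1 + rV * ((((L ^ kk : ℕ) : ℝ))⁻¹)) ^ ((d + 1) * L ^ kk) - 1))) + ((1 + rV * ((((L ^ kk : ℕ) : ℝ))⁻¹)) ^ ((d + 1) * L ^ kk) - 1) + (((L ^ mv : ℕ) : ℝ))⁻¹ + Real.exp (-(δ₀ * dZ z)) := add_nonneg hSum0 (Real.exp_nonneg _)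
    calc B₇ * ((((L ^ kk : ℕ) : ℝ)) ^ (d + 1))⁻¹ * (rV * (1 + Fintype.card (Fin (d + 1) ⊕ Fin (d + 1))) + aK a₀ (L : ℝ) kk * (Fintype.card ι * (Fintype.card ι * ((1 + rV * ((((L ^ kk : ℕ) : ℝ))⁻¹)) ^ ((d + 1) * L ^ kk) - 1) ^ 2 + 2 * ((1 + rV * ((((L ^ kk : ℕ) : ℝ))⁻¹)) ^ ((d + 1) * L ^ kk) - 1))) + ((1 + rV * ((((L ^ kk : ℕ) : ℝ))⁻¹)) ^ ((d + 1) * L ^ kk) - 1) + (((L ^ mv : ℕ) : ℝ))⁻¹ + Real.exp (-(δ₇ * dZ z))) * Real.exp (-(δ₇ * (unitTorusGeo L kk (cvM d L mv kk hL)).dist z w))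
        ≤ B₇ * ((((L ^ kk : ℕ) : ℝ)) ^ (d + 1))⁻¹ * (rV * (1 + Fintype.card (Fin (d + 1) ⊕ Fin (d + 1))) + aK a₀ (L : ℝ) kk * (Fintype.card ι * (Fintype.card ι * ((1 + rV * ((((L ^ kk : ℕ) : ℝ))⁻¹)) ^ ((d + 1) * L ^ kk) - 1) ^ 2 + 2 * ((1 + rV * ((((L ^ kk : ℕ) : ℝ))⁻¹)) ^ ((d + 1) * L ^ kk) - 1))) + ((1 + rV * ((((L ^ kk : ℕ) : ℝ))⁻¹)) ^ ((d + 1) * L ^ kk) - 1) + (((L ^ mv : ℕ) : ℝ))⁻¹ + Real.exp (-(δ₀ * dZ z))) * Real.exp (-(δ₇ * (unitTorusGeo L kk (cvM d L mv kk hL)).dist z w)) :=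
          mul_le_mul_of_nonneg_right (mul_le_mul_of_nonneg_left (add_le_add le_rfl e1) hB) (Real.exp_nonneg _)
      _ ≤ B₇ * ((((L ^ kk : ℕ) : ℝ)) ^ (d + 1))⁻¹ * (rV * (1 + Fintype.card (Fin (d + 1) ⊕ Fin (d + 1))) + aK a₀ (L : ℝ) kk * (Fintype.card ι * (Fintype.card ι * ((1 + rV * ((((L ^ kk : ℕ) : ℝ))⁻¹)) ^ ((d + 1) * L ^ kk) - 1) ^ 2 + 2 * ((1 + rV * ((((L ^ kk : ℕ) : ℝ))⁻¹)) ^ ((d + 1) * L ^ kk) - 1))) + ((1 + rV * ((((L ^ kk : ℕ) : ℝ))⁻¹)) ^ ((d + 1) * L ^ kk) - 1) + (((L ^ mv : ℕ) : ℝ))⁻¹ + Real.exp (-(δ₀ * dZ z))) * Real.exp (-(δ₀ * (unitTorusGeo L kk (cvM d L mv kk hL)).dist z w)) := mul_le_mul_of_nonneg_left e2 (mul_nonneg hB h0)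
      _ = _ := by ring
  have hEVρ : HasMaj (BlockNorm.ofBlocks (unitTorusGeo L kk (cvM d L mv kk hL)) (liftBlk (fun y : Tor (cvM d L mv kk hL) => y) ι)) (BlockNorm.ofBlocks (unitTorusGeo L kk (cvM d L mv kk hL)) (liftBlk (fun b : ScX d L mv kk hL × Fin (d + 1) => blockOf (L ^ kk) (cvM d L mv kk hL) b.1) ι)) (Matrix.mulVecLin (cE (cvM d L mv kk hL) (L ^ kk) (cvT e (fun μ x => (U μ x : Matrix mm mm ℂ))) (aK a₀ (L : ℝ) kk * (((L ^ kk : ℕ) : ℝ)) ^ (d + 1)))) (fun z w => 1 * (B₇ * ((((L ^ kk : ℕ) : ℝ)) ^ (d + 1))⁻¹ * Real.exp (-(δ₀ * (unitTorusGeo L kk (cvM d L mv kk hL)).dist z w)))) :=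
    hEV.mono fun z w => (hrate (c := B₇ * ((((L ^ kk : ℕ) : ℝ)) ^ (d + 1))⁻¹) (ρ := δ₇) (ρ' := δ₀) (by positivity) hδ₀₇ z w).trans_eq (one_mul _).symm
  have hEVρ2 : HasMaj (BlockNorm.ofBlocks (unitTorusGeo L kk (cvM d L mv kk hL)) (liftBlk (fun y : Tor (cvM d L mv kk hL) => y) ι)) (BlockNorm.ofBlocks (unitTorusGeo L kk (cvM d L mv kk hL)) (liftBlk (fun b : ScX d L mv kk hL × Fin (d + 1) => blockOf (L ^ kk) (cvM d L mv kk hL) b.1) ι)) (Matrix.mulVecLin (cE (cvM d L mv kk hL) (L ^ kk) (cvT e (fun μ x => (U μ x : Matrix mm mm ℂ))) (aK a₀ (L : ℝ) kk * (((L ^ kk : ℕ) : ℝ)) ^ (d + 1)))) (fun z w => 1 * (B₇ * ((((L ^ kk : ℕ) : ℝ)) ^ (d + 1))⁻¹ * Real.exp (-(δ₀ / 2 * (unitTorusGeo L kk (cvM d L mv kk hL)).dist z w)))) :=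
    hEV.mono fun z w => (hrate (c := B₇ * ((((L ^ kk : ℕ) : ℝ)) ^ (d + 1))⁻¹) (ρ := δ₇) (ρ' := δ₀ / 2) (by positivity) (by linarith) z w).trans_eq (one_mul _).symm
  have hE1ρ : HasMaj (BlockNorm.ofBlocks (unitTorusGeo L kk (cvM d L mv kk hL)) (liftBlk (fun y : Tor (cvM d L mv kk hL) => y) ι)) (BlockNorm.ofBlocks (unitTorusGeo L kk (cvM d L mv kk hL)) (liftBlk (fun b : ScX d L mv kk hL × Fin (d + 1) => blockOf (L ^ kk) (cvM d L mv kk hL) b.1) ι)) (Matrix.mulVecLin (cE (cvM d L mv kk hL) (L ^ kk) (fun (_ : Fin (d + 1)) (_ : ScX d L mv kk hL) => (1 : Matrix ι ι ℝ)) (aK a₀ (L : ℝ) kk * (((L ^ kk : ℕ) : ℝ)) ^ (d + 1)))) (fun z w => 1 * (B₇ * ((((L ^ kk : ℕ) : ℝ)) ^ (d + 1))⁻¹ * Real.exp (-(δ₀ * (unitTorusGeo L kk (cvM d L mv kk hL)).dist z w)))) :=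
    hE1.mono fun z w => (hrate (c := B₇ * ((((L ^ kk : ℕ) : ℝ)) ^ (d + 1))⁻¹) (ρ := δ₇) (ρ' := δ₀) (by positivity) hδ₀₇ z w).trans_eq (one_mul _).symm
  have hE1h : HasMaj (BlockNorm.ofBlocks (unitTorusGeo L kk (cvM d L mv kk hL)) (liftBlk (fun y : Tor (cvM d L mv kk hL) => y) ι)) (BlockNorm.ofBlocks (unitTorusGeo L kk (cvM d L mv kk hL)) (liftBlk (fun b : ScX d L mv kk hL × Fin (d + 1) => blockOf (L ^ kk) (cvM d L mv kk hL) b.1) ι)) (Matrix.mulVecLin (cE (cvM d L mv kk hL) (L ^ kk) (fun (_ : Fin (d + 1)) (_ : ScX d L mv kk hL) => (1 : Matrix ι ι ℝ)) (aK a₀ (L : ℝ) kk * (((L ^ kk : ℕ) : ℝ)) ^ (d + 1)))) (fun z w => B₇ * ((((L ^ kk : ℕ) : ℝ)) ^ (d + 1))⁻¹ * Real.exp (-(δ₀ * (unitTorusGeo L kk (cvM d L mv kk hL)).dist z w))) :=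
    hE1.mono (hrate (c := B₇ * ((((L ^ kk : ℕ) : ℝ)) ^ (d + 1))⁻¹) (ρ := δ₇) (ρ' := δ₀) (by positivity) hδ₀₇)
  have hSV' : HasMaj (BlockNorm.ofBlocks (unitTorusGeo L kk (cvM d L mv kk hL)) (liftBlk (fun y : Tor (cvM d L mv kk hL) => y) ι)) (BlockNorm.ofBlocks (unitTorusGeo L kk (cvM d L mv kk hL)) (liftBlk (fun y : Tor (cvM d L mv kk hL) => y) ι)) (Matrix.mulVecLin (cSop (cvM d L mv kk hL) (L ^ kk) (cvT e (fun μ x => (U μ x : Matrix mm mm ℂ))) (aK a₀ (L : ℝ) kk * (((L ^ kk : ℕ) : ℝ)) ^ (d + 1)))⁻¹) (fun w w' => BI * (((L ^ kk : ℕ) : ℝ)) ^ (d + 1) * Real.exp (-(δ₀ * (unitTorusGeo L kk (cvM d L mv kk hL)).dist w w'))) :=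
    hSi.mono (hrate (c := BI * (((L ^ kk : ℕ) : ℝ)) ^ (d + 1)) (ρ := δI) (ρ' := δ₀) (by positivity) hδ₀I)
  have hS1' : HasMaj (BlockNorm.ofBlocks (unitTorusGeo L kk (cvM d L mv kk hL)) (liftBlk (fun y : Tor (cvM d L mv kk hL) => y) ι)) (BlockNorm.ofBlocks (unitTorusGeo L kk (cvM d L mv kk hL)) (liftBlk (fun y : Tor (cvM d L mv kk hL) => y) ι)) (Matrix.mulVecLin (cSop (cvM d L mv kk hL) (L ^ kk) (fun (_ : Fin (d + 1)) (_ : ScX d L mv kk hL) => (1 : Matrix ι ι ℝ)) (aK a₀ (L : ℝ) kk * (((L ^ kk : ℕ) : ℝ)) ^ (d + 1)))⁻¹) (fun w w' => CS * (((L ^ kk : ℕ) : ℝ)) ^ (d + 1) * Real.exp (-(δ₀ * (unitTorusGeo L kk (cvM d L mv kk hL)).dist w w'))) :=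
    (HS (aK a₀ (L : ℝ) kk) (haKlo kk hk) (aK_le ha₀ hL1r hk) (cvM d L mv kk hL) (L ^ kk) kk ι).mono (hrate (c := CS * (((L ^ kk : ℕ) : ℝ)) ^ (d + 1)) (ρ := δS) (ρ' := δ₀) (by positivity) hδ₀S)
  have hδSi' : HasMaj (BlockNorm.ofBlocks (unitTorusGeo L kk (cvM d L mv kk hL)) (liftBlk (fun y : Tor (cvM d L mv kk hL) => y) ι)) (BlockNorm.ofBlocks (unitTorusGeo L kk (cvM d L mv kk hL)) (liftBlk (fun y : Tor (cvM d L mv kk hL) => y) ι)) (Matrix.mulVecLin (cSop (cvM d L mv kk hL) (L ^ kk) (cvT e (fun μ x => (U μ x : Matrix mm mm ℂ))) (aK a₀ (L : ℝ) kk * (((L ^ kk : ℕ) : ℝ)) ^ (d + 1)))⁻¹ - Matrix.mulVecLin (cSop (cvM d L mv kk hL) (L ^ kk) (fun (_ : Fin (d + 1)) (_ : ScX d L mv kk hL) => (1 : Matrix ι ι ℝ)) (aK a₀ (L : ℝ) kk * (((L ^ kk : ℕ) : ℝ)) ^ (d + 1)))⁻¹)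
      (fun z y' => (rV * (1 + Fintype.card (Fin (d + 1) ⊕ Fin (d + 1))) + aK a₀ (L : ℝ) kk * (Fintype.card ι * (Fintype.card ι * ((1 + rV * ((((L ^ kk : ℕ) : ℝ))⁻¹)) ^ ((d + 1) * L ^ kk) - 1) ^ 2 + 2 * ((1 + rV * ((((L ^ kk : ℕ) : ℝ))⁻¹)) ^ ((d + 1) * L ^ kk) - 1))) + ((1 + rV * ((((L ^ kk : ℕ) : ℝ))⁻¹)) ^ ((d + 1) * L ^ kk) - 1) + (((L ^ mv : ℕ) : ℝ))⁻¹ + 1 * Real.exp (-(δ₀ * dZ z))) * (B₈ * (((L ^ kk : ℕ) : ℝ)) ^ (d + 1) * Real.exp (-(δ₀ * (unitTorusGeo L kk (cvM d L mv kk hL)).dist z y')))) := by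
    refine hδSi.mono fun z y' => ?_
    have e1 := hexpZ hδ₀₈ z
    have e2 := hexp hδ₀₈ z y'
    have hB : (0 : ℝ) ≤ B₈ * (((L ^ kk : ℕ) : ℝ)) ^ (d + 1) := by positivity
    have h0 : 0 ≤ rV * (1 + Fintype.card (Fin (d + 1) ⊕ Fin (d + 1))) + aK a₀ (L : ℝ) kk * (Fintype.card ι * (Fintype.card ι * ((1 + rV * ((((L ^ kk : ℕ) : ℝ))⁻¹)) ^ ((d + 1) * L ^ kk) - 1) ^ 2 + 2 * ((1 + rV * ((((L ^ kk : ℕ) : ℝ))⁻¹)) ^ ((d + 1) * L ^ kk) - 1))) + ((1 + rV * ((((L ^ kk : ℕ) : ℝ))⁻¹)) ^ ((d + 1) * L ^ kk) - 1) + (((L ^ mv : ℕ) : ℝ))⁻¹ + 1 * Real.exp (-(δ₀ * dZ z)) := add_nonneg hSum0 (by positivity)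
    calc (rV * (1 + Fintype.card (Fin (d + 1) ⊕ Fin (d + 1))) + aK a₀ (L : ℝ) kk * (Fintype.card ι * (Fintype.card ι * ((1 + rV * ((((L ^ kk : ℕ) : ℝ))⁻¹)) ^ ((d + 1) * L ^ kk) - 1) ^ 2 + 2 * ((1 + rV * ((((L ^ kk : ℕ) : ℝ))⁻¹)) ^ ((d + 1) * L ^ kk) - 1))) + ((1 + rV * ((((L ^ kk : ℕ) : ℝ))⁻¹)) ^ ((d + 1) * L ^ kk) - 1) + (((L ^ mv : ℕ) : ℝ))⁻¹ + 1 * Real.exp (-(δ₈ * dZ z))) * (B₈ * (((L ^ kk : ℕ) : ℝ)) ^ (d + 1) * Real.exp (-(δ₈ * (unitTorusGeo L kk (cvM d L mv kk hL)).dist z y')))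
        ≤ (rV * (1 + Fintype.card (Fin (d + 1) ⊕ Fin (d + 1))) + aK a₀ (L : ℝ) kk * (Fintype.card ι * (Fintype.card ι * ((1 + rV * ((((L ^ kk : ℕ) : ℝ))⁻¹)) ^ ((d + 1) * L ^ kk) - 1) ^ 2 + 2 * ((1 + rV * ((((L ^ kk : ℕ) : ℝ))⁻¹)) ^ ((d + 1) * L ^ kk) - 1))) + ((1 + rV * ((((L ^ kk : ℕ) : ℝ))⁻¹)) ^ ((d + 1) * L ^ kk) - 1) + (((L ^ mv : ℕ) : ℝ))⁻¹ + 1 * Real.exp (-(δ₀ * dZ z))) * (B₈ * (((L ^ kk : ℕ) : ℝ)) ^ (d + 1) * Real.exp (-(δ₈ * (unitTorusGeo L kk (cvM d L mv kk hL)).dist z y'))) :=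
          mul_le_mul_of_nonneg_right (add_le_add le_rfl (mul_le_mul_of_nonneg_left e1 zero_le_one)) (mul_nonneg hB (Real.exp_nonneg _))
      _ ≤ (rV * (1 + Fintype.card (Fin (d + 1) ⊕ Fin (d + 1))) + aK a₀ (L : ℝ) kk * (Fintype.card ι * (Fintype.card ι * ((1 + rV * ((((L ^ kk : ℕ) : ℝ))⁻¹)) ^ ((d + 1) * L ^ kk) - 1) ^ 2 + 2 * ((1 + rV * ((((L ^ kk : ℕ) : ℝ))⁻¹)) ^ ((d + 1) * L ^ kk) - 1))) + ((1 + rV * ((((L ^ kk : ℕ) : ℝ))⁻¹)) ^ ((d + 1) * L ^ kk) - 1) + (((L ^ mv : ℕ) : ℝ))⁻¹ + 1 * Real.exp (-(δ₀ * dZ z))) * (B₈ * (((L ^ kk : ℕ) : ℝ)) ^ (d + 1) * Real.exp (-(δ₀ * (unitTorusGeo L kk (cvM d L mv kk hL)).dist z y'))) := mul_le_mul_of_nonneg_left (mul_le_mul_of_nonneg_left e2 hB) h0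
  -- word 2's left factor `E(𝟙)·(S(U)⁻¹ − S(𝟙)⁻¹)`: the weight moves from the coarse middle to the fine output (Lipschitz `d_Z`)
  have hcomp := hasMaj_comp_nfW dZ (s := rV * (1 + Fintype.card (Fin (d + 1) ⊕ Fin (d + 1))) + aK a₀ (L : ℝ) kk * (Fintype.card ι * (Fintype.card ι * ((1 + rV * ((((L ^ kk : ℕ) : ℝ))⁻¹)) ^ ((d + 1) * L ^ kk) - 1) ^ 2 + 2 * ((1 + rV * ((((L ^ kk : ℕ) : ℝ))⁻¹)) ^ ((d + 1) * L ^ kk) - 1))) + ((1 + rV * ((((L ^ kk : ℕ) : ℝ))⁻¹)) ^ ((d + 1) * L ^ kk) - 1) + (((L ^ mv : ℕ) : ℝ))⁻¹) (f := 1) (c := δ₀) (m := m) (ρ := δ₀ / 2)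
    htri hd hrow hdZl hdZ0 (by positivity : (0 : ℝ) ≤ B₇ * ((((L ^ kk : ℕ) : ℝ)) ^ (d + 1))⁻¹) (by positivity : (0 : ℝ) ≤ B₈ * (((L ^ kk : ℕ) : ℝ)) ^ (d + 1)) hSum0 zero_le_one hm.le (by rw [hmdef]; linarith) (by positivity) (by linarith)
    (by rw [hmdef]; linarith) hE1h hδSi'
  have hA2 : HasMaj (BlockNorm.ofBlocks (unitTorusGeo L kk (cvM d L mv kk hL)) (liftBlk (fun y : Tor (cvM d L mv kk hL) => y) ι)) (BlockNorm.ofBlocks (unitTorusGeo L kk (cvM d L mv kk hL)) (liftBlk (fun b : ScX d L mv kk hL × Fin (d + 1) => blockOf (L ^ kk) (cvM d L mv kk hL) b.1) ι)) (Matrix.mulVecLin (cE (cvM d L mv kk hL) (L ^ kk) (fun (_ : Fin (d + 1)) (_ : ScX d L mv kk hL) => (1 : Matrix ι ι ℝ)) (aK a₀ (L : ℝ) kk * (((L ^ kk : ℕ) : ℝ)) ^ (d + 1)) * ((cSop (cvM d L mv kk hL) (L ^ kk) (cvT e (fun μ x => (U μ x : Matrix mm mm ℂ))) (aK a₀ (L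 : ℝ) kk * (((L ^ kk : ℕ) : ℝ)) ^ (d + 1)))⁻¹ - (cSop (cvM d L mv kk hL) (L ^ kk) (fun (_ : Fin (d + 1)) (_ : ScX d L mv kk hL) => (1 : Matrix ι ι ℝ)) (aK a₀ (L : ℝ) kk * (((L ^ kk : ℕ) : ℝ)) ^ (d + 1)))⁻¹)))
      (fun z w => (rV * (1 + Fintype.card (Fin (d + 1) ⊕ Fin (d + 1))) + aK a₀ (L : ℝ) kk * (Fintype.card ι * (Fintype.card ι * ((1 + rV * ((((L ^ kk : ℕ) : ℝ))⁻¹)) ^ ((d + 1) * L ^ kk) - 1) ^ 2 + 2 * ((1 + rV * ((((L ^ kk : ℕ) : ℝ))⁻¹)) ^ ((d + 1) * L ^ kk) - 1))) + ((1 + rV * ((((L ^ kk : ℕ) : ℝ))⁻¹)) ^ ((d + 1) * L ^ kk) - 1) + (((L ^ mv : ℕ) : ℝ))⁻¹ + 1 * Real.exp (-(m * dZ z))) * ((BlockNorm.ofBlocks (unitTorusGeo L kk (cvM d L mv kk hL)) (liftBlk (fun y : Tor (cvM d L mv kk hL) => y) ι)).κ * (B₇ * ((((L ^ kk : ℕ)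 : ℝ)) ^ (d + 1))⁻¹) * (B₈ * (((L ^ kk : ℕ) : ℝ)) ^ (d + 1)) * cr * Real.exp (-(δ₀ / 2 * (unitTorusGeo L kk (cvM d L mv kk hL)).dist z w)))) := by
    rw [Matrix.mulVecLin_mul, mulVecLin_sub']
    exact hcomp
  have hId : HasMaj (BlockNorm.ofBlocks (unitTorusGeo L kk (cvM d L mv kk hL)) (liftBlk (fun y : Tor (cvM d L mv kk hL) => y) ι)) (BlockNorm.ofBlocks (unitTorusGeo L kk (cvM d L mv kk hL)) (liftBlk (fun y : Tor (cvM d L mv kk hL) => y) ι)) (Matrix.mulVecLin (1 : Matrix (Tor (cvM d L mv kk hL) × ι) (Tor (cvM d L mv kk hL) × ι) ℝ)) (fun w w' => 1 * Real.exp (-(δ₀ / 2 * (unitTorusGeo L kk (cvM d L mv kk hL)).dist w w'))) := by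
    rw [Matrix.mulVecLin_one]
    exact hasMaj_id_ofBlocks _ hdself _
  -- the three words (n15-c∕306)
  have hW1 := hasMaj_mul_mul_transpose_expW (g := (unitTorusGeo L kk (cvM d L mv kk hL))) (liftBlk (fun b : ScX d L mv kk hL × Fin (d + 1) => blockOf (L ^ kk) (cvM d L mv kk hL) b.1) ι) (liftBlk (fun y : Tor (cvM d L mv kk hL) => y) ι)
    (u := fun z => rV * (1 + Fintype.card (Fin (d + 1) ⊕ Fin (d + 1))) + aK a₀ (L : ℝ) kk * (Fintype.card ι * (Fintype.card ι * ((1 + rV * ((((L ^ kk : ℕ) : ℝ))⁻¹)) ^ ((d + 1) * L ^ kk) - 1) ^ 2 + 2 * ((1 + rV * ((((L ^ kk : ℕ) : ℝ))⁻¹)) ^ ((d + 1) * L ^ kk) - 1))) + ((1 + rV * ((((L ^ kk : ℕ) : ℝ))⁻¹)) ^ ((d + 1) * L ^ kk) - 1) + (((L ^ mv : ℕ) : ℝ))⁻¹ + Real.exp (-(δ₀ * dZ z))) (v := fun _ => (1 : ℝ))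
    htri hd hsymm hrow hm (by linarith : m ≤ δ₀) (by positivity : (0 : ℝ) ≤ B₇ * ((((L ^ kk : ℕ) : ℝ)) ^ (d + 1))⁻¹) (by positivity : (0 : ℝ) ≤ B₇ * ((((L ^ kk : ℕ) : ℝ)) ^ (d + 1))⁻¹) (by positivity : (0 : ℝ) ≤ BI * (((L ^ kk : ℕ) : ℝ)) ^ (d + 1))
    (fun z => add_nonneg hSum0 (Real.exp_nonneg _)) (fun _ => zero_le_one) hblk hblkC hA1 hEVρ hSV'
  have hW2 := hasMaj_mul_mul_transpose_expW (g := (unitTorusGeo L kk (cvM d L mv kk hL))) (liftBlk (fun b : ScX d L mv kk hL × Fin (d + 1) => blockOf (L ^ kk) (cvM d L mv kk hL) b.1) ι) (liftBlk (fun y : Tor (cvM d L mv kk hL) => y) ι)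
    (u := fun z => rV * (1 + Fintype.card (Fin (d + 1) ⊕ Fin (d + 1))) + aK a₀ (L : ℝ) kk * (Fintype.card ι * (Fintype.card ι * ((1 + rV * ((((L ^ kk : ℕ) : ℝ))⁻¹)) ^ ((d + 1) * L ^ kk) - 1) ^ 2 + 2 * ((1 + rV * ((((L ^ kk : ℕ) : ℝ))⁻¹)) ^ ((d + 1) * L ^ kk) - 1))) + ((1 + rV * ((((L ^ kk : ℕ) : ℝ))⁻¹)) ^ ((d + 1) * L ^ kk) - 1) + (((L ^ mv : ℕ) : ℝ))⁻¹ + 1 * Real.exp (-(m * dZ z))) (v := fun _ => (1 : ℝ))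
    htri hd hsymm hrow hm (by rw [hmdef]; linarith : m ≤ δ₀ / 2) (mul_nonneg (mul_nonneg (mul_nonneg hκ0 (by positivity)) (by positivity)) hcr0) (by positivity : (0 : ℝ) ≤ B₇ * ((((L ^ kk : ℕ) : ℝ)) ^ (d + 1))⁻¹) zero_le_one
    (fun z => add_nonneg hSum0 (by positivity)) (fun _ => zero_le_one) hblk hblkC hA2 hEVρ2 hId
  rw [Matrix.mul_one] at hW2
  have hW3 := hasMaj_mul_mul_transpose_expW (g := (unitTorusGeo L kk (cvM d L mv kk hL))) (liftBlk (fun b : ScX d L mv kk hL × Fin (d + 1) => blockOf (L ^ kk) (cvM d L mv kk hL) b.1) ι) (liftBlk (fun y : Tor (cvM d L mv kk hL) => y) ι)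
    (u := fun _ => (1 : ℝ)) (v := fun z => rV * (1 + Fintype.card (Fin (d + 1) ⊕ Fin (d + 1))) + aK a₀ (L : ℝ) kk * (Fintype.card ι * (Fintype.card ι * ((1 + rV * ((((L ^ kk : ℕ) : ℝ))⁻¹)) ^ ((d + 1) * L ^ kk) - 1) ^ 2 + 2 * ((1 + rV * ((((L ^ kk : ℕ) : ℝ))⁻¹)) ^ ((d + 1) * L ^ kk) - 1))) + ((1 + rV * ((((L ^ kk : ℕ) : ℝ))⁻¹)) ^ ((d + 1) * L ^ kk) - 1) + (((L ^ mv : ℕ) : ℝ))⁻¹ + Real.exp (-(δ₀ * dZ z)))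
    htri hd hsymm hrow hm (by linarith : m ≤ δ₀) (by positivity : (0 : ℝ) ≤ B₇ * ((((L ^ kk : ℕ) : ℝ)) ^ (d + 1))⁻¹) (by positivity : (0 : ℝ) ≤ B₇ * ((((L ^ kk : ℕ) : ℝ)) ^ (d + 1))⁻¹) (by positivity : (0 : ℝ) ≤ CS * (((L ^ kk : ℕ) : ℝ)) ^ (d + 1))
    (fun _ => zero_le_one) (fun z => add_nonneg hSum0 (Real.exp_nonneg _)) hblk hblkC hE1ρ hA1 hS1'
  -- the constants: the bond-block cardinal cancels the scales
  have hK1 : ((((d + 1) * (L ^ kk) ^ (d + 1) * Fintype.card ι : ℕ)) : ℝ) * ((Fintype.card ι : ℕ) : ℝ) * ((Fintype.card ι : ℕ) : ℝ) * (B₇ * ((((L ^ kk : ℕ) : ℝ)) ^ (d + 1))⁻¹) * (BI * (((L ^ kk : ℕ) : ℝ)) ^ (d + 1)) * (B₇ * ((((L ^ kk : ℕ) : ℝ)) ^ (d + 1))⁻¹) * (cr * cr) = (((d + 1 : ℕ) : ℝ) * ((Fintype.card ι : ℝ) * (Fintype.card ι : ℝ) * (Fintype.card ι : ℝ)) * (B₇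 * B₇) * BI * (cr * cr)) := by
    have e : ((((d + 1) * (L ^ kk) ^ (d + 1) * Fintype.card ι : ℕ)) : ℝ) * ((Fintype.card ι : ℕ) : ℝ) * ((Fintype.card ι : ℕ) : ℝ) * (B₇ * ((((L ^ kk : ℕ) : ℝ)) ^ (d + 1))⁻¹) * (BI * (((L ^ kk : ℕ) : ℝ)) ^ (d + 1)) * (B₇ * ((((L ^ kk : ℕ) : ℝ)) ^ (d + 1))⁻¹) * (cr * cr) = (((d + 1 : ℕ) : ℝ) * ((Fintype.card ι : ℝ) * (Fintype.card ι : ℝ) * (Fintype.card ι : ℝ)) * (B₇ * B₇) * BI * (cr * cr)) * ((((((L ^ kk : ℕ) : ℝ)) ^ (d + 1))⁻¹ * (((L ^ kk : ℕ) : ℝ)) ^ (d + 1)) * (((((L ^ kk : ℕ) : ℝ)) ^ (d + 1))⁻¹ * (((L ^ kk : ℕ) : ℝ)) ^ (d + 1))) := by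
      push_cast; ring
    rw [e, hnn, mul_one, mul_one]
  have hK2 : ((((d + 1) * (L ^ kk) ^ (d + 1) * Fintype.card ι : ℕ)) : ℝ) * ((Fintype.card ι : ℕ) : ℝ) * ((Fintype.card ι : ℕ) : ℝ) * ((BlockNorm.ofBlocks (unitTorusGeo L kk (cvM d L mv kk hL)) (liftBlk (fun y : Tor (cvM d L mv kk hL) => y) ι)).κ * (B₇ * ((((L ^ kk : ℕ) : ℝ)) ^ (d + 1))⁻¹) * (B₈ * (((L ^ kk : ℕ) : ℝ)) ^ (d + 1)) * cr) * 1 * (B₇ * ((((L ^ kk : ℕ) : ℝ)) ^ (d + 1))⁻¹) * (cr * cr) = (((d + 1 : ℕ) : ℝ) * ((Fintype.card ι : ℝ) * (Fintype.card ι : ℝ) * (Fintype.card ι : ℝ)) * (B₇ * B₇) * B₈ * (cr * cr * cr)) := by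
    have e : ((((d + 1) * (L ^ kk) ^ (d + 1) * Fintype.card ι : ℕ)) : ℝ) * ((Fintype.card ι : ℕ) : ℝ) * ((Fintype.card ι : ℕ) : ℝ) * ((BlockNorm.ofBlocks (unitTorusGeo L kk (cvM d L mv kk hL)) (liftBlk (fun y : Tor (cvM d L mv kk hL) => y) ι)).κ * (B₇ * ((((L ^ kk : ℕ) : ℝ)) ^ (d + 1))⁻¹) * (B₈ * (((L ^ kk : ℕ) : ℝ)) ^ (d + 1)) * cr) * 1 * (B₇ * ((((L ^ kk : ℕ) : ℝ)) ^ (d + 1))⁻¹) * (cr * cr) = (((d + 1 : ℕ) : ℝ) * ((Fintype.card ι : ℝ) * (Fintype.card ι : ℝ) * (Fintype.card ι : ℝ)) * (B₇ * B₇) * B₈ * (cr * cr * cr)) * ((((((L ^ kk : ℕ) : ℝ)) ^ (d + 1))⁻¹ * (((L ^ kk : ℕ) : ℝ)) ^ (d + 1)) * (((((L ^ kk : ℕ) : ℝ)) ^ (d + 1))⁻¹ * (((L ^ kk : ℕ) : ℝ)) ^ (d + 1))) * (BlockNorm.ofBlocks (unitTorusGeo L kk (cvM d L mv kk hL)) (liftBlk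 (fun y : Tor (cvM d L mv kk hL) => y) ι)).κ := by
      push_cast; ring
    rw [e, hnn, hκ, mul_one, mul_one, mul_one]
  have hK3 : ((((d + 1) * (L ^ kk) ^ (d + 1) * Fintype.card ι : ℕ)) : ℝ) * ((Fintype.card ι : ℕ) : ℝ) * ((Fintype.card ι : ℕ) : ℝ) * (B₇ * ((((L ^ kk : ℕ) : ℝ)) ^ (d + 1))⁻¹) * (CS * (((L ^ kk : ℕ) : ℝ)) ^ (d + 1)) * (B₇ * ((((L ^ kk : ℕ) : ℝ)) ^ (d + 1))⁻¹) * (cr * cr) = (((d + 1 : ℕ) : ℝ) * ((Fintype.card ι : ℝ) * (Fintype.card ι : ℝ) * (Fintype.card ι : ℝ)) * (B₇ * B₇) * CS * (cr * cr)) := by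
    have e : ((((d + 1) * (L ^ kk) ^ (d + 1) * Fintype.card ι : ℕ)) : ℝ) * ((Fintype.card ι : ℕ) : ℝ) * ((Fintype.card ι : ℕ) : ℝ) * (B₇ * ((((L ^ kk : ℕ) : ℝ)) ^ (d + 1))⁻¹) * (CS * (((L ^ kk : ℕ) : ℝ)) ^ (d + 1)) * (B₇ * ((((L ^ kk : ℕ) : ℝ)) ^ (d + 1))⁻¹) * (cr * cr) = (((d + 1 : ℕ) : ℝ) * ((Fintype.card ι : ℝ) * (Fintype.card ι : ℝ) * (Fintype.card ι : ℝ)) * (B₇ * B₇) * CS * (cr * cr)) * ((((((L ^ kk : ℕ) : ℝ)) ^ (d + 1))⁻¹ * (((L ^ kk : ℕ) : ℝ)) ^ (d + 1)) * (((((L ^ kk : ℕ) : ℝ)) ^ (d + 1))⁻¹ * (((L ^ kk : ℕ) : ℝ)) ^ (d + 1))) := by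
      push_cast; ring
    rw [e, hnn, mul_one, mul_one]
  -- clean the three words to the common weight rate ∕ decay rate `m`
  have hW1c : HasMaj (BlockNorm.ofBlocks (unitTorusGeo L kk (cvM d L mv kk hL)) (liftBlk (fun b : ScX d L mv kk hL × Fin (d + 1) => blockOf (L ^ kk) (cvM d L mv kk hL) b.1) ι)) (BlockNorm.ofBlocks (unitTorusGeo L kk (cvM d L mv kk hL)) (liftBlk (fun b : ScX d L mv kk hL × Fin (d + 1) => blockOf (L ^ kk) (cvM d L mv kk hL) b.1) ι)) (Matrix.mulVecLin ((cE (cvM d L mv kk hL) (L ^ kk) (cvT e (fun μ x => (U μ x : Matrix mm mm ℂ))) (aK a₀ (L : ℝ) kk * (((L ^ kk : ℕ) : ℝ)) ^ (d + 1)) - cE (cvM d L mv kk hL) (L ^ kk) (fun (_ : Fin (d + 1)) (_ : ScX d L mv kk hL) => (1 : Matrix ι ι ℝ)) (aK a₀ (L : ℝ) kk * (((L ^ kk : ℕ) : ℝ)) ^ (d + 1))) * (cSop (cvM d L mv kk hL) (L ^ kk) (cvT e (fun μ x => (U μ x : Matrix mm mm ℂ))) (aK a₀ (L : ℝ) kk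 * (((L ^ kk : ℕ) : ℝ)) ^ (d + 1)))⁻¹ * (cE (cvM d L mv kk hL) (L ^ kk) (cvT e (fun μ x => (U μ x : Matrix mm mm ℂ))) (aK a₀ (L : ℝ) kk * (((L ^ kk : ℕ) : ℝ)) ^ (d + 1)))ᵀ))
      (fun z z' => (rV * (1 + Fintype.card (Fin (d + 1) ⊕ Fin (d + 1))) + aK a₀ (L : ℝ) kk * (Fintype.card ι * (Fintype.card ι * ((1 + rV * ((((L ^ kk : ℕ) : ℝ))⁻¹)) ^ ((d + 1) * L ^ kk) - 1) ^ 2 + 2 * ((1 + rV * ((((L ^ kk : ℕ) : ℝ))⁻¹)) ^ ((d + 1) * L ^ kk) - 1))) + ((1 + rV * ((((L ^ kk : ℕ) : ℝ))⁻¹)) ^ ((d + 1) * L ^ kk) - 1) + (((L ^ mv : ℕ) : ℝ))⁻¹ + Real.exp (-(m * dZ z))) * ((((d + 1 : ℕ) : ℝ) * ((Fintype.card ι : ℝ) * (Fintype.card ι : ℝ) * (Fintype.card ι : ℝ)) * (B₇ * B₇) * BI * (cr * cr)) * Real.exp (-(m * (unitTorusGeo L kk (cvM d L mv kk hL)).dist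 z z')))) :=
    hW1.mono fun z z' => wb_left hSum0 (Real.exp_nonneg _) (hexpZ (by linarith : m ≤ δ₀) z) rfl hK1 hK1c0 (Real.exp_nonneg _) (hexp (by rw [hmdef]; linarith : m ≤ δ₀ - m) z z')
  have hW2c : HasMaj (BlockNorm.ofBlocks (unitTorusGeo L kk (cvM d L mv kk hL)) (liftBlk (fun b : ScX d L mv kk hL × Fin (d + 1) => blockOf (L ^ kk) (cvM d L mv kk hL) b.1) ι)) (BlockNorm.ofBlocks (unitTorusGeo L kk (cvM d L mv kk hL)) (liftBlk (fun b : ScX d L mv kk hL × Fin (d + 1) => blockOf (L ^ kk) (cvM d L mv kk hL) b.1) ι)) (Matrix.mulVecLin (cE (cvM d L mv kk hL) (L ^ kk) (fun (_ : Fin (d + 1)) (_ : ScX d L mv kk hL) => (1 : Matrix ι ι ℝ)) (aK a₀ (L : ℝ) kk * (((L ^ kk : ℕ) : ℝ)) ^ (d + 1)) * ((cSop (cvM d L mv kk hL) (L ^ kk) (cvT e (fun μ x => (U μ x : Matrix mm mm ℂ))) (aK a₀ (L : ℝ) kk * (((L ^ kk : ℕ) : ℝ)) ^ (d + 1)))⁻¹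 - (cSop (cvM d L mv kk hL) (L ^ kk) (fun (_ : Fin (d + 1)) (_ : ScX d L mv kk hL) => (1 : Matrix ι ι ℝ)) (aK a₀ (L : ℝ) kk * (((L ^ kk : ℕ) : ℝ)) ^ (d + 1)))⁻¹) * (cE (cvM d L mv kk hL) (L ^ kk) (cvT e (fun μ x => (U μ x : Matrix mm mm ℂ))) (aK a₀ (L : ℝ) kk * (((L ^ kk : ℕ) : ℝ)) ^ (d + 1)))ᵀ))
      (fun z z' => (rV * (1 + Fintype.card (Fin (d + 1) ⊕ Fin (d + 1))) + aK a₀ (L : ℝ) kk * (Fintype.card ι * (Fintype.card ι * ((1 + rV * ((((L ^ kk : ℕ) : ℝ))⁻¹)) ^ ((d + 1) * L ^ kk) - 1) ^ 2 + 2 * ((1 + rV * ((((L ^ kk : ℕ) : ℝ))⁻¹)) ^ ((d + 1) * L ^ kk) - 1))) + ((1 + rV * ((((L ^ kk : ℕ) : ℝ))⁻¹)) ^ ((d + 1) * L ^ kk) - 1) + (((L ^ mv : ℕ) : ℝ))⁻¹ + Real.exp (-(m * dZ z))) * ((((d + 1 : ℕ) : ℝ) * ((Fintype.card ι : ℝ)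 * (Fintype.card ι : ℝ) * (Fintype.card ι : ℝ)) * (B₇ * B₇) * B₈ * (cr * cr * cr)) * Real.exp (-(m * (unitTorusGeo L kk (cvM d L mv kk hL)).dist z z')))) :=
    hW2.mono fun z z' => wb_left hSum0 (by positivity) (le_of_eq (one_mul _)) rfl hK2 hK2c0 (Real.exp_nonneg _) (hexp (by rw [hmdef]; linarith : m ≤ δ₀ / 2 - m) z z')
  have hW3c : HasMaj (BlockNorm.ofBlocks (unitTorusGeo L kk (cvM d L mv kk hL)) (liftBlk (fun b : ScX d L mv kk hL × Fin (d + 1) => blockOf (L ^ kk) (cvM d L mv kk hL) b.1) ι)) (BlockNorm.ofBlocks (unitTorusGeo L kk (cvM d L mv kk hL)) (liftBlk (fun b : ScX d L mv kk hL × Fin (d + 1) => blockOf (L ^ kk) (cvM d L mv kk hL) b.1) ι)) (Matrix.mulVecLin (cE (cvM d L mv kk hL) (L ^ kk) (fun (_ : Fin (d + 1)) (_ : ScX d L mv kk hL) => (1 : Matrix ι ι ℝ)) (aK a₀ (L : ℝ) kk * (((L ^ kk : ℕ) : ℝ)) ^ (d + 1)) * (cSop (cvM d L mv kk hL) (L ^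 kk) (fun (_ : Fin (d + 1)) (_ : ScX d L mv kk hL) => (1 : Matrix ι ι ℝ)) (aK a₀ (L : ℝ) kk * (((L ^ kk : ℕ) : ℝ)) ^ (d + 1)))⁻¹ * (cE (cvM d L mv kk hL) (L ^ kk) (cvT e (fun μ x => (U μ x : Matrix mm mm ℂ))) (aK a₀ (L : ℝ) kk * (((L ^ kk : ℕ) : ℝ)) ^ (d + 1)) - cE (cvM d L mv kk hL) (L ^ kk) (fun (_ : Fin (d + 1)) (_ : ScX d L mv kk hL) => (1 : Matrix ι ι ℝ)) (aK a₀ (L : ℝ) kk * (((L ^ kk : ℕ) : ℝ)) ^ (d + 1)))ᵀ))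
      (fun z z' => (rV * (1 + Fintype.card (Fin (d + 1) ⊕ Fin (d + 1))) + aK a₀ (L : ℝ) kk * (Fintype.card ι * (Fintype.card ι * ((1 + rV * ((((L ^ kk : ℕ) : ℝ))⁻¹)) ^ ((d + 1) * L ^ kk) - 1) ^ 2 + 2 * ((1 + rV * ((((L ^ kk : ℕ) : ℝ))⁻¹)) ^ ((d + 1) * L ^ kk) - 1))) + ((1 + rV * ((((L ^ kk : ℕ) : ℝ))⁻¹)) ^ ((d + 1) * L ^ kk) - 1) + (((L ^ mv : ℕ) : ℝ))⁻¹ + Real.exp (-(m * dZ z'))) * ((((d + 1 : ℕ) : ℝ) * ((Fintype.card ι : ℝ) * (Fintype.card ι : ℝ) * (Fintype.card ι : ℝ)) * (B₇ * B₇) * CS * (cr * cr)) * Real.exp (-(m * (unitTorusGeo L kk (cvM d L mv kk hL)).dist z z')))) :=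
    hW3.mono fun z z' => wb_right hSum0 (Real.exp_nonneg _) (hexpZ (by linarith : m ≤ δ₀) z') rfl hK3 hK3c0 (Real.exp_nonneg _) (hexp (by rw [hmdef]; linarith : m ≤ δ₀ - m) z z')
  -- assemble
  rw [← mulVecLin_sub', landauCov_sub_factorised, Matrix.mulVecLin_add, Matrix.mulVecLin_add]
  refine ((hW1c.add hW2c).add hW3c).mono fun z z' => ?_
  exact sum3_le hSum0 (Real.exp_nonneg _) (Real.exp_nonneg _) hK1c0 hK2c0 hK3c0 (Real.exp_nonneg _)

end Letter

end Summit.QuantumFields.YangMills.BalabanUVNodes.N15.Gluing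

end
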